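import Summits.AtomisticToContinuum.HydrodynamicLimit.Theses.ZenoDiameterTransfer

/-!
# Birth skeleton — piece X2 `TwinEntropyIdentity` of the decomposition of `DiluteEntropicTwin`
(stmt-AtomisticToContinuum-12207; crux-strategist, 2026-08-17)

Two stubs and the composition `TwinEntropyIdentity_of` (sorry-free; sorries only in the stubs):
* `stub_logGibbs_expectation` — STATIC half: under the twin law at time `r` (supported on the hard-sphere
  domain, a probability measure) the log of the canonical local Gibbs density with the time-`r` profiles is
  `−log Z_N(r) + (N+1)Λ_r` (`Λ_r` = per-particle tilt through the empirical fields, `integral_empiricalMeasure`),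
  and `Λ_r` is integrable (Gaussian velocity moments + energy conservation), so
  `E_(P_r)[log ψ_r] = −log Z_N(r) + (N+1) E_(P_r)[Λ_r]`;
* `stub_klDiv_transport` — DYNAMIC half: `klDiv(P_s ‖ Q_s) = ofReal(E_(P_0)[log ψ_0] − E_(P_s)[log ψ_s])`
  (transport of densities on the good set, `dP_s/dQ_s = ψ_0∘Φ_(−s)/ψ_s`, Liouville invariance of `∫ f log f`,
  both laws probability so the `klDiv` mass corrections cancel; Yau 1991 §2, Saint-Raymond 2009 Lemma 3.1.1).
The composition divides by `N+1` inside `ENNReal.ofReal`.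
-/

namespace Summit.AtomisticToContinuum.HydrodynamicLimit.Cruxes.DiluteEntropicTwin.TwinEntropyIdentity

set_option linter.dupNamespace false

open scoped BigOperators Topology ENNReal
open Filter Set MeasureTheory

/-- The piece (verbatim the staged sub-item `TwinEntropyIdentity`). -/
def TwinEntropyIdentity : Prop :=
  ∀ (T' : ℝ) (ρ' θ' : ℝ → Literature.MathematicalPhysics.KineticTheory.T3 → ℝ) (u' : ℝ → Literature.MathematicalPhysics.KineticTheory.T3 → Literature.MathematicalPhysics.KineticTheory.V3), Literature.MathematicalPhysics.KineticTheory.IsHardSphereEulerSolution 0 T' ρ' u' θ' → ∀ ε' : ℕ → ℝ, (∀ N : ℕ, 0 < ε' N ∧ ε' N < 2⁻¹) → ∀ Φ' : (N : ℕ) → Literature.Analysis.FluidPDE.HardSphereFlow (Literature.Analysis.FluidPDE.Torus.geometry (Fin 3)) (ε' N) (N + 1), (∀ N : ℕ, MeasureTheory.IsProbabilityMeasure (Literature.Analysis.FluidPDE.particleLaw (Φ' N) (Literature.Analysis.FluidPDE.canonicalDensity (Literature.Analysis.FluidPDE.Torus.geometry (Fin 3)) (ε' N) (N + 1) (Literature.MathematicalPhysics.KineticTheory.localGibbsProfile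 (ρ' 0) (u' 0) (θ' 0))))) → ∀ N : ℕ, ∀ s ∈ Set.Ico 0 T', InformationTheory.klDiv ((Φ' N).lawAt (Literature.Analysis.FluidPDE.particleLaw (Φ' N) (Literature.Analysis.FluidPDE.canonicalDensity (Literature.Analysis.FluidPDE.Torus.geometry (Fin 3)) (ε' N) (N + 1) (Literature.MathematicalPhysics.KineticTheory.localGibbsProfile (ρ' 0) (u' 0) (θ' 0)))) s) (Literature.Analysis.FluidPDE.particleLaw (Φ' N) (Literature.Analysis.FluidPDE.canonicalDensity (Literature.Analysis.FluidPDE.Torus.geometry (Fin 3)) (ε' N) (N + 1) (Literature.MathematicalPhysics.KineticTheory.localGibbsProfile (ρ' s) (u' s) (θ' s)))) / ((N : ENNReal) + 1) = ENNReal.ofReal ((∫ z, (Literature.MathematicalPhysics.KineticTheory.empiricalDensityField z (fun x => Real.log (ρ' 0 x) - 3 / 2 * Real.log (2 * Real.pi * θ' 0 x) - ‖u' 0 x‖ ^ 2 / (2 * θ' 0 x)) + (∑ k : Fin 3, Literature.MathematicalPhysics.KineticTheory.empiricalMomentumField z (fun x => (u' 0 x) k / θ' 0 x) k) - Literature.MathematicalPhysics.KineticTheory.empiricalEnergyField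 z (fun x => (θ' 0 x)⁻¹)) ∂((Φ' N).lawAt (Literature.Analysis.FluidPDE.particleLaw (Φ' N) (Literature.Analysis.FluidPDE.canonicalDensity (Literature.Analysis.FluidPDE.Torus.geometry (Fin 3)) (ε' N) (N + 1) (Literature.MathematicalPhysics.KineticTheory.localGibbsProfile (ρ' 0) (u' 0) (θ' 0)))) 0)) - (∫ z, (Literature.MathematicalPhysics.KineticTheory.empiricalDensityField z (fun x => Real.log (ρ' s x) - 3 / 2 * Real.log (2 * Real.pi * θ' s x) - ‖u' s x‖ ^ 2 / (2 * θ' s x)) + (∑ k : Fin 3, Literature.MathematicalPhysics.KineticTheory.empiricalMomentumField z (fun x => (u' s x) k / θ' s x) k) - Literature.MathematicalPhysics.KineticTheory.empiricalEnergyField z (fun x => (θ' s x)⁻¹)) ∂((Φ' N).lawAt (Literature.Analysis.FluidPDE.particleLaw (Φ' N) (Literature.Analysis.FluidPDE.canonicalDensity (Literature.Analysis.FluidPDE.Torus.geometry (Fin 3)) (ε' N) (N + 1) (Literature.MathematicalPhysics.KineticTheory.localGibbsProfile (ρ' 0) (u' 0) (θ' 0)))) s)) + (Real.log (Literature.Analysis.FluidPDE.canonicalPartition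 (Literature.Analysis.FluidPDE.Torus.geometry (Fin 3)) (ε' N) (N + 1) (Literature.MathematicalPhysics.KineticTheory.localGibbsProfile (ρ' s) (u' s) (θ' s))) / ((N : ℝ) + 1) - Real.log (Literature.Analysis.FluidPDE.canonicalPartition (Literature.Analysis.FluidPDE.Torus.geometry (Fin 3)) (ε' N) (N + 1) (Literature.MathematicalPhysics.KineticTheory.localGibbsProfile (ρ' 0) (u' 0) (θ' 0))) / ((N : ℝ) + 1)))

/-- Stub 1 — static: expectation of the log Gibbs density = −log Z + (N+1)·(tilt expectation). -/
theorem stub_logGibbs_expectation :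
    ∀ (T' : ℝ) (ρ' θ' : ℝ → Literature.MathematicalPhysics.KineticTheory.T3 → ℝ) (u' : ℝ → Literature.MathematicalPhysics.KineticTheory.T3 → Literature.MathematicalPhysics.KineticTheory.V3), Literature.MathematicalPhysics.KineticTheory.IsHardSphereEulerSolution 0 T' ρ' u' θ' → ∀ ε' : ℕ → ℝ, (∀ N : ℕ, 0 < ε' N ∧ ε' N < 2⁻¹) → ∀ Φ' : (N : ℕ) → Literature.Analysis.FluidPDE.HardSphereFlow (Literature.Analysis.FluidPDE.Torus.geometry (Fin 3)) (ε' N) (N + 1), (∀ N : ℕ, MeasureTheory.IsProbabilityMeasure (Literature.Analysis.FluidPDE.particleLaw (Φ' N) (Literature.Analysis.FluidPDE.canonicalDensity (Literature.Analysis.FluidPDE.Torus.geometry (Fin 3)) (ε' N) (N + 1) (Literature.MathematicalPhysics.KineticTheory.localGibbsProfile (ρ' 0) (u' 0) (θ' 0))))) → ∀ N : ℕ, ∀ r ∈ Set.Ico 0 T', MeasureTheory.Integrable (fun z : Literature.Analysis.FluidPDE.Config (N + 1) (Fin 3) Literature.MathematicalPhysics.KineticTheory.T3 => (Literature.MathematicalPhysics.KineticTheory.empiricalDensityField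 z (fun x => Real.log (ρ' r x) - 3 / 2 * Real.log (2 * Real.pi * θ' r x) - ‖u' r x‖ ^ 2 / (2 * θ' r x)) + (∑ k : Fin 3, Literature.MathematicalPhysics.KineticTheory.empiricalMomentumField z (fun x => (u' r x) k / θ' r x) k) - Literature.MathematicalPhysics.KineticTheory.empiricalEnergyField z (fun x => (θ' r x)⁻¹))) ((Φ' N).lawAt (Literature.Analysis.FluidPDE.particleLaw (Φ' N) (Literature.Analysis.FluidPDE.canonicalDensity (Literature.Analysis.FluidPDE.Torus.geometry (Fin 3)) (ε' N) (N + 1) (Literature.MathematicalPhysics.KineticTheory.localGibbsProfile (ρ' 0) (u' 0) (θ' 0)))) r) ∧ (∫ z, Real.log ((Literature.Analysis.FluidPDE.canonicalDensity (Literature.Analysis.FluidPDE.Torus.geometry (Fin 3)) (ε' N) (N + 1) (Literature.MathematicalPhysics.KineticTheory.localGibbsProfile (ρ' r) (u' r) (θ' r))) z) ∂((Φ' N).lawAt (Literature.Analysis.FluidPDE.particleLaw (Φ' N) (Literature.Analysis.FluidPDE.canonicalDensity (Literature.Analysis.FluidPDE.Torus.geometry (Fin 3)) (ε' N) (N + 1)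 (Literature.MathematicalPhysics.KineticTheory.localGibbsProfile (ρ' 0) (u' 0) (θ' 0)))) r)) = - Real.log (Literature.Analysis.FluidPDE.canonicalPartition (Literature.Analysis.FluidPDE.Torus.geometry (Fin 3)) (ε' N) (N + 1) (Literature.MathematicalPhysics.KineticTheory.localGibbsProfile (ρ' r) (u' r) (θ' r))) + ((N : ℝ) + 1) * (∫ z, (Literature.MathematicalPhysics.KineticTheory.empiricalDensityField z (fun x => Real.log (ρ' r x) - 3 / 2 * Real.log (2 * Real.pi * θ' r x) - ‖u' r x‖ ^ 2 / (2 * θ' r x)) + (∑ k : Fin 3, Literature.MathematicalPhysics.KineticTheory.empiricalMomentumField z (fun x => (u' r x) k / θ' r x) k) - Literature.MathematicalPhysics.KineticTheory.empiricalEnergyField z (fun x => (θ' r x)⁻¹)) ∂((Φ' N).lawAt (Literature.Analysis.FluidPDE.particleLaw (Φ' N) (Literature.Analysis.FluidPDE.canonicalDensity (Literature.Analysis.FluidPDE.Torus.geometry (Fin 3)) (ε' N) (N + 1) (Literature.MathematicalPhysics.KineticTheory.localGibbsProfile (ρ' 0) (u' 0) (θ' 0)))) r)) := by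
  sorry

/-- Stub 2 — dynamic: the relative entropy along the flow through the transported density. -/
theorem stub_klDiv_transport :
    ∀ (T' : ℝ) (ρ' θ' : ℝ → Literature.MathematicalPhysics.KineticTheory.T3 → ℝ) (u' : ℝ → Literature.MathematicalPhysics.KineticTheory.T3 → Literature.MathematicalPhysics.KineticTheory.V3), Literature.MathematicalPhysics.KineticTheory.IsHardSphereEulerSolution 0 T' ρ' u' θ' → ∀ ε' : ℕ → ℝ, (∀ N : ℕ, 0 < ε' N ∧ ε' N < 2⁻¹) → ∀ Φ' : (N : ℕ) → Literature.Analysis.FluidPDE.HardSphereFlow (Literature.Analysis.FluidPDE.Torus.geometry (Fin 3)) (ε' N) (N + 1), (∀ N : ℕ, MeasureTheory.IsProbabilityMeasure (Literature.Analysis.FluidPDE.particleLaw (Φ' N) (Literature.Analysis.FluidPDE.canonicalDensity (Literature.Analysis.FluidPDE.Torus.geometry (Fin 3)) (ε' N) (N + 1) (Literature.MathematicalPhysics.KineticTheory.localGibbsProfile (ρ' 0) (u' 0) (θ' 0))))) → ∀ N : ℕ, ∀ s ∈ Set.Ico 0 T', InformationTheory.klDiv ((Φ' N).lawAt (Literature.Analysis.FluidPDE.particleLaw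 (Φ' N) (Literature.Analysis.FluidPDE.canonicalDensity (Literature.Analysis.FluidPDE.Torus.geometry (Fin 3)) (ε' N) (N + 1) (Literature.MathematicalPhysics.KineticTheory.localGibbsProfile (ρ' 0) (u' 0) (θ' 0)))) s) (Literature.Analysis.FluidPDE.particleLaw (Φ' N) (Literature.Analysis.FluidPDE.canonicalDensity (Literature.Analysis.FluidPDE.Torus.geometry (Fin 3)) (ε' N) (N + 1) (Literature.MathematicalPhysics.KineticTheory.localGibbsProfile (ρ' s) (u' s) (θ' s)))) = ENNReal.ofReal ((∫ z, Real.log ((Literature.Analysis.FluidPDE.canonicalDensity (Literature.Analysis.FluidPDE.Torus.geometry (Fin 3)) (ε' N) (N + 1) (Literature.MathematicalPhysics.KineticTheory.localGibbsProfile (ρ' 0) (u' 0) (θ' 0))) z) ∂((Φ' N).lawAt (Literature.Analysis.FluidPDE.particleLaw (Φ' N) (Literature.Analysis.FluidPDE.canonicalDensity (Literature.Analysis.FluidPDE.Torus.geometry (Fin 3)) (ε' N) (N + 1) (Literature.MathematicalPhysics.KineticTheory.localGibbsProfile (ρ' 0) (u' 0) (θ' 0)))) 0)) - (∫ z, Real.log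 ((Literature.Analysis.FluidPDE.canonicalDensity (Literature.Analysis.FluidPDE.Torus.geometry (Fin 3)) (ε' N) (N + 1) (Literature.MathematicalPhysics.KineticTheory.localGibbsProfile (ρ' s) (u' s) (θ' s))) z) ∂((Φ' N).lawAt (Literature.Analysis.FluidPDE.particleLaw (Φ' N) (Literature.Analysis.FluidPDE.canonicalDensity (Literature.Analysis.FluidPDE.Torus.geometry (Fin 3)) (ε' N) (N + 1) (Literature.MathematicalPhysics.KineticTheory.localGibbsProfile (ρ' 0) (u' 0) (θ' 0)))) s))) := by
  sorry

/-- **Composition** (kernel-checked): substitute the static formula at `0` and at `s` into the transport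
identity and divide by `N + 1` inside `ENNReal.ofReal`. -/
theorem TwinEntropyIdentity_of : TwinEntropyIdentity := by
  have hS1 := stub_logGibbs_expectation
  have hS2 := stub_klDiv_transport
  intro T' ρ' θ' u' hE ε' hε' Φ' hprob N s hs
  have hT : 0 < T' := lt_of_le_of_lt hs.1 hs.2
  have h0 : (0 : ℝ) ∈ Set.Ico 0 T' := ⟨le_rfl, hT⟩
  rw [hS2 T' ρ' θ' u' hE ε' hε' Φ' hprob N s hs, (hS1 T' ρ' θ' u' hE ε' hε' Φ' hprob N 0 h0).2,
    (hS1 T' ρ' θ' u' hE ε' hε' Φ' hprob N s hs).2]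
  have hpos : (0 : ℝ) < (N : ℝ) + 1 := by positivity
  have hN1 : ENNReal.ofReal ((N : ℝ) + 1) = (N : ℝ≥0∞) + 1 := by
    rw [ENNReal.ofReal_add (by positivity) zero_le_one, ENNReal.ofReal_natCast, ENNReal.ofReal_one]
  rw [← hN1, ← ENNReal.ofReal_div_of_pos hpos]
  congr 1
  generalize (∫ z, (Literature.MathematicalPhysics.KineticTheory.empiricalDensityField z (fun x => Real.log (ρ' 0 x) - 3 / 2 * Real.log (2 * Real.pi * θ' 0 x) - ‖u' 0 x‖ ^ 2 / (2 * θ' 0 x)) + (∑ k : Fin 3, Literature.MathematicalPhysics.KineticTheory.empiricalMomentumField z (fun x => (u' 0 x) k / θ' 0 x) k) - Literature.MathematicalPhysics.KineticTheory.empiricalEnergyField z (fun x => (θ' 0 x)⁻¹)) ∂((Φ' N).lawAt (Literature.Analysis.FluidPDE.particleLaw (Φ' N) (Literature.Analysis.FluidPDE.canonicalDensity (Literature.Analysis.FluidPDE.Torus.geometry (Fin 3)) (ε' N) (N + 1) (Literature.MathematicalPhysics.KineticTheory.localGibbsProfile (ρ' 0) (u' 0) (θ' 0)))) 0)) = a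
  generalize (∫ z, (Literature.MathematicalPhysics.KineticTheory.empiricalDensityField z (fun x => Real.log (ρ' s x) - 3 / 2 * Real.log (2 * Real.pi * θ' s x) - ‖u' s x‖ ^ 2 / (2 * θ' s x)) + (∑ k : Fin 3, Literature.MathematicalPhysics.KineticTheory.empiricalMomentumField z (fun x => (u' s x) k / θ' s x) k) - Literature.MathematicalPhysics.KineticTheory.empiricalEnergyField z (fun x => (θ' s x)⁻¹)) ∂((Φ' N).lawAt (Literature.Analysis.FluidPDE.particleLaw (Φ' N) (Literature.Analysis.FluidPDE.canonicalDensity (Literature.Analysis.FluidPDE.Torus.geometry (Fin 3)) (ε' N) (N + 1) (Literature.MathematicalPhysics.KineticTheory.localGibbsProfile (ρ' 0) (u' 0) (θ' 0)))) s)) = b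
  generalize Real.log (Literature.Analysis.FluidPDE.canonicalPartition (Literature.Analysis.FluidPDE.Torus.geometry (Fin 3)) (ε' N) (N + 1) (Literature.MathematicalPhysics.KineticTheory.localGibbsProfile (ρ' 0) (u' 0) (θ' 0))) = c
  generalize Real.log (Literature.Analysis.FluidPDE.canonicalPartition (Literature.Analysis.FluidPDE.Torus.geometry (Fin 3)) (ε' N) (N + 1) (Literature.MathematicalPhysics.KineticTheory.localGibbsProfile (ρ' s) (u' s) (θ' s))) = d
  field_simp
  ring

end Summit.AtomisticToContinuum.HydrodynamicLimit.Cruxes.DiluteEntropicTwin.TwinEntropyIdentity
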